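import Summits.AtomisticToContinuum.BoseEinsteinCondensation.Theorems.BECInsertionCorrectorCorrectorClosureLongWaveStructureOfSRBBoxCount
import Literature.MathematicalPhysics.QuantumManyBody.PeriodicBoseGasLemma32
import HarnessLib

/-!
# Crux `CorrectorClosure` (stmt-AtomisticToContinuum-12058), line `volume-homotopy-sum-rule-domination` —
# registered stub `stub_longWaveStructureOfSRB`, auxiliary file 3/4: the box second moment of a torus
# state as a mode sum of its structure factor

Supports (does not close) stmt-AtomisticToContinuum-12058, route `BECInsertionCorrector`.

For a periodic trial state `Ψ` of `N` bosons on the torus of side `L > 0` and periodised sliding boxes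
`Λ_ℓ(u)`, `0 ≤ ℓ ≤ L`, the `u`-averaged second moment of the particle number in the box is the mode sum
(`boxMoment_eq_tsum`; Tonelli, the per-configuration Parseval identity `lintegral_boxCount_sq_eq_tsum`
of file 2/4, and `∫ Σ' = Σ' ∫` in `[0, ∞]`)

  `∫_cell ∫_{cell^N} (Σⱼ Σ_m 1[xⱼ + Lm ∈ Λ_ℓ(u)])² |Ψ|² dX du = L⁻³ Σ_{p ∈ ℤ³} |B_p|² ‖ρ_p†Ψ‖²`,

`‖ρ_p†Ψ‖² = ∫_{cell^N} |Σⱼ e_p(xⱼ)|² |Ψ|²`.  The one-particle case bounds the total box weight,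
`Σ_p |B_p|² ≤ 27 L³ ℓ³` (`tsum_sq_boxCoeff_le`: the count at the origin is `≤ 27` on the cell and its
cell integral is `|Λ_ℓ| = ℓ³` by tiling, `tsum_lintegral_cell_sub_latticeVec`), whence the working form
`boxMoment_le_of_sq_moment_le`: if `‖ρ_p†Ψ‖² ≤ S N` for all `p ≠ 0`, the box moment is
`≤ N² ℓ⁶/L³ + 27 S N ℓ³` (`B_0 = ℓ³`, `‖ρ_0†Ψ‖² = N²`).

## References

* [PitaevskiiStringari1991] L. Pitaevskii, S. Stringari, *Uncertainty principle, quantum fluctuations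
  and broken symmetries*, J. Low Temp. Phys. 85 (1991), (8)–(11).
-/

noncomputable section

open MeasureTheory Filter Set Complex
open scoped ENNReal NNReal Topology ComplexConjugate BigOperators

namespace Summit.AtomisticToContinuum.BoseEinsteinCondensation.Theorems.CorrectorClosure.VolumeHomotopySumRuleDomination

open Literature.MathematicalPhysics.QuantumManyBody.BoseGas
open Summit.AtomisticToContinuum.BoseEinsteinCondensation.Theorems.SumRuleChainGlue
  (mem_slidingBox_comm boxCoeff_zero measurable_boxCount')

variable {N : ℕ} {L ℓ : ℝ}

/-! ### The total box weight `Σ_p |B_p|² ≤ 27 L³ ℓ³` -/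

/-- The one-particle box count at the origin, `G₀(u) = Σ_m 1[Lm ∈ Λ_ℓ(u)]`, is at most `27` on the
cell (`ℓ ≤ L`). [folklore] -/
theorem boxCount_origin_le (hL : 0 < L) (hℓL : ℓ ≤ L) {u : Space} (hu : u ∈ cell L) :
    (∑' m : Fin 3 → ℤ, (slidingBox ℓ u).indicator (fun _ => (1 : ℝ≥0∞)) (0 + latticeVec L m)) ≤ 27 := by
  have hX₀mem : (fun _ : Fin 1 => (0 : Space)) ∈ cellN 1 L := fun _ k => by
    simp only [PiLp.zero_apply, Set.mem_Ico]
    exact ⟨le_rfl, hL⟩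
  have h := boxCount_eq_ofReal_nearSum hℓL hX₀mem hu
  have hle := nearSum_le ℓ L (fun _ : Fin 1 => (0 : Space)) u
  simp only [Fin.sum_univ_one, Nat.cast_one, mul_one] at h hle
  rw [h]
  calc _ ≤ ENNReal.ofReal 27 := ENNReal.ofReal_le_ofReal hle
    _ = 27 := by norm_num

/-- The cell integral of the one-particle box count at the origin is `|Λ_ℓ(0)| = ℓ³` (tiling of `ℝ³`
by the translates of the cell). [folklore] -/
theorem lintegral_boxCount_origin (hL : 0 < L) (ℓ : ℝ) :
    ∫⁻ u in cell L, ∑' m : Fin 3 → ℤ,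
        (slidingBox ℓ u).indicator (fun _ => (1 : ℝ≥0∞)) (0 + latticeVec L m) =
      ENNReal.ofReal ℓ ^ 3 := by
  have hind : ∀ (u : Space) (m : Fin 3 → ℤ),
      (slidingBox ℓ u).indicator (fun _ => (1 : ℝ≥0∞)) (0 + latticeVec L m) =
        (slidingBox ℓ 0).indicator (fun _ => (1 : ℝ≥0∞)) (u - latticeVec L m) := by
    intro u m
    have hiff : 0 + latticeVec L m ∈ slidingBox ℓ u ↔ u - latticeVec L m ∈ slidingBox ℓ 0 := by
      rw [zero_add, mem_slidingBox_comm, mem_slidingBox_iff_sub]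
    by_cases h : 0 + latticeVec L m ∈ slidingBox ℓ u
    · rw [Set.indicator_of_mem h, Set.indicator_of_mem (hiff.1 h)]
    · rw [Set.indicator_of_notMem h, Set.indicator_of_notMem (fun h' => h (hiff.2 h'))]
  have hmeas : ∀ m : Fin 3 → ℤ, Measurable fun u : Space =>
      (slidingBox ℓ 0).indicator (fun _ => (1 : ℝ≥0∞)) (u - latticeVec L m) := fun m =>
    (measurable_const.indicator (measurableSet_slidingBox ℓ 0)).comp (measurable_id.sub_const _)
  simp only [hind]
  rw [lintegral_tsum fun m => (hmeas m).aemeasurable,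
    tsum_lintegral_cell_sub_latticeVec hL ((slidingBox ℓ 0).indicator fun _ => (1 : ℝ≥0∞)),
    lintegral_indicator_const (measurableSet_slidingBox ℓ 0), one_mul, volume_slidingBox]

/-- **The total box weight**: for `0 ≤ ℓ ≤ L`, `Σ_p |B_p|² ≤ 27 L³ ℓ³` (Parseval for the one-particle
box count at the origin: the count is at most `27` on the cell and its cell integral is `|Λ_ℓ| = ℓ³`
by tiling). [folklore] -/
theorem tsum_sq_boxCoeff_le (hL : 0 < L) (hℓ : 0 ≤ ℓ) (hℓL : ℓ ≤ L) :
    ∑' p : Fin 3 → ℤ, ENNReal.ofReal (‖∫ y in slidingBox ℓ 0, conj (cellWave L p y)‖ ^ 2) ≤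
      ENNReal.ofReal (27 * L ^ 3 * ℓ ^ 3) := by
  -- one particle at the origin
  have hX₀mem : (fun _ : Fin 1 => (0 : Space)) ∈ cellN 1 L := fun _ k => by
    simp only [PiLp.zero_apply, Set.mem_Ico]
    exact ⟨le_rfl, hL⟩
  -- Parseval for one particle: `Σ_p |B_p|² = L³ ∫_cell G₀²`
  have hP := lintegral_boxCount_sq_eq_tsum hL hℓL hX₀mem
  simp only [Fin.sum_univ_one, norm_cellWave, one_pow, ENNReal.ofReal_one, mul_one] at hP
  have hL3 : ENNReal.ofReal (L ^ 3) * ENNReal.ofReal ((L ^ 3)⁻¹) = 1 := by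
    rw [← ENNReal.ofReal_mul (by positivity), mul_inv_cancel₀ (pow_pos hL 3).ne', ENNReal.ofReal_one]
  have hsum : ∑' p : Fin 3 → ℤ, ENNReal.ofReal (‖∫ y in slidingBox ℓ 0, conj (cellWave L p y)‖ ^ 2) =
      ENNReal.ofReal (L ^ 3) * ∫⁻ u in cell L, (∑' m : Fin 3 → ℤ,
        (slidingBox ℓ u).indicator (fun _ => (1 : ℝ≥0∞)) (0 + latticeVec L m)) ^ 2 := by
    rw [hP, ← mul_assoc, hL3, one_mul]
  have hmeasG : Measurable fun u : Space => ∑' m : Fin 3 → ℤ,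
      (slidingBox ℓ u).indicator (fun _ => (1 : ℝ≥0∞)) (0 + latticeVec L m) := by
    have h := (measurable_boxCount' (N := 1) ℓ L).comp
      (measurable_id.prodMk (measurable_const (a := fun _ : Fin 1 => (0 : Space))))
    simpa only [Function.comp_def, id_eq, Fin.sum_univ_one] using h
  -- assemble: `Σ_p |B_p|² = L³ ∫ G₀² ≤ L³ · 27 ∫ G₀ = 27 L³ ℓ³`
  rw [hsum]
  calc ENNReal.ofReal (L ^ 3) * ∫⁻ u in cell L, (∑' m : Fin 3 → ℤ,
        (slidingBox ℓ u).indicator (fun _ => (1 : ℝ≥0∞)) (0 + latticeVec L m)) ^ 2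
      ≤ ENNReal.ofReal (L ^ 3) * ∫⁻ u in cell L, 27 * ∑' m : Fin 3 → ℤ,
          (slidingBox ℓ u).indicator (fun _ => (1 : ℝ≥0∞)) (0 + latticeVec L m) := by
        refine mul_le_mul_of_nonneg_left ?_ bot_le
        refine setLIntegral_mono' (measurableSet_cell L) fun u hu => ?_
        rw [sq]
        exact mul_le_mul_of_nonneg_right (boxCount_origin_le hL hℓL hu) bot_le
    _ = ENNReal.ofReal (27 * L ^ 3 * ℓ ^ 3) := by
        rw [lintegral_const_mul _ hmeasG, lintegral_boxCount_origin hL ℓ, ← ENNReal.ofReal_pow hℓ,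
          show (27 : ℝ≥0∞) = ENNReal.ofReal 27 by norm_num, ← ENNReal.ofReal_mul (by positivity),
          ← ENNReal.ofReal_mul (by positivity)]
        congr 1
        ring

/-! ### The box second moment as a mode sum, and the working bound -/

/-- **The box second moment as a mode sum** (Tonelli and Parseval in the box centre): for a periodic
trial state `Ψ` and `ℓ ≤ L`,
`∫_cell ∫_{cell^N} (Σⱼ Σ_m 1[xⱼ + Lm ∈ Λ_ℓ(u)])² |Ψ|² dX du = L⁻³ Σ_p |B_p|² ‖ρ_p†Ψ‖²`.
[cite: PitaevskiiStringari1991, (8)–(11)] -/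
theorem boxMoment_eq_tsum (hL : 0 < L) (hℓL : ℓ ≤ L) (Ψ : PeriodicTrialState N L) :
    ∫⁻ u in cell L, ∫⁻ X in cellN N L, (∑ j : Fin N, ∑' m : Fin 3 → ℤ,
        (slidingBox ℓ u).indicator (fun _ => (1 : ℝ≥0∞)) (X j + latticeVec L m)) ^ 2 *
          (‖Ψ.ψ X‖₊ : ℝ≥0∞) ^ 2 =
      ENNReal.ofReal ((L ^ 3)⁻¹) * ∑' p : Fin 3 → ℤ,
        ENNReal.ofReal (‖∫ y in slidingBox ℓ 0, conj (cellWave L p y)‖ ^ 2) *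
          ∫⁻ X in cellN N L, (‖∑ j : Fin N, cellWave L p (X j)‖₊ : ℝ≥0∞) ^ 2 *
            (‖Ψ.ψ X‖₊ : ℝ≥0∞) ^ 2 := by
  set G : Space → Config N → ℝ≥0∞ := fun u X => ∑ j : Fin N, ∑' m : Fin 3 → ℤ,
    (slidingBox ℓ u).indicator (fun _ => (1 : ℝ≥0∞)) (X j + latticeVec L m) with hG
  -- Tonelli: integrate over `u` first (as in `density_sum_le_boxMoment`)
  have hF : Measurable fun q : Space × Config N => G q.1 q.2 ^ 2 * (‖Ψ.ψ q.2‖₊ : ℝ≥0∞) ^ 2 :=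
    ((measurable_boxCount' ℓ L).pow_const 2).mul (Ψ.measurable_normSq.comp measurable_snd)
  have hswap : ∫⁻ u in cell L, ∫⁻ X in cellN N L, G u X ^ 2 * (‖Ψ.ψ X‖₊ : ℝ≥0∞) ^ 2 =
      ∫⁻ X in cellN N L, (∫⁻ u in cell L, G u X ^ 2) * (‖Ψ.ψ X‖₊ : ℝ≥0∞) ^ 2 := by
    rw [lintegral_lintegral_swap
      (hF.aemeasurable (μ := (volume.restrict (cell L)).prod (volume.restrict (cellN N L))))]
    refine lintegral_congr fun X => ?_
    rw [lintegral_mul_const' _ _ (ENNReal.pow_ne_top ENNReal.coe_ne_top)]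
  show ∫⁻ u in cell L, ∫⁻ X in cellN N L, G u X ^ 2 * (‖Ψ.ψ X‖₊ : ℝ≥0∞) ^ 2 = _
  rw [hswap]
  -- the inner integral, per configuration of the cell
  have hinner : EqOn (fun X => (∫⁻ u in cell L, G u X ^ 2) * (‖Ψ.ψ X‖₊ : ℝ≥0∞) ^ 2)
      (fun X => ENNReal.ofReal ((L ^ 3)⁻¹) * ∑' p : Fin 3 → ℤ,
        ENNReal.ofReal (‖∫ y in slidingBox ℓ 0, conj (cellWave L p y)‖ ^ 2) *
          ((‖∑ j : Fin N, cellWave L p (X j)‖₊ : ℝ≥0∞) ^ 2 * (‖Ψ.ψ X‖₊ : ℝ≥0∞) ^ 2))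
      (cellN N L) := by
    intro X hX
    show (∫⁻ u in cell L, G u X ^ 2) * (‖Ψ.ψ X‖₊ : ℝ≥0∞) ^ 2 = _
    rw [hG, lintegral_boxCount_sq_eq_tsum hL hℓL hX, mul_assoc, ← ENNReal.tsum_mul_right]
    congr 1
    refine tsum_congr fun p => ?_
    rw [coe_nnnorm_sq_eq_ofReal (∑ j : Fin N, cellWave L p (X j)), mul_assoc]
  rw [setLIntegral_congr_fun (measurableSet_cellN N L) hinner,
    lintegral_const_mul' _ _ ENNReal.ofReal_ne_top]
  congr 1
  have hmeas : ∀ p : Fin 3 → ℤ, Measurable fun X : Config N =>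
      ENNReal.ofReal (‖∫ y in slidingBox ℓ 0, conj (cellWave L p y)‖ ^ 2) *
        ((‖∑ j : Fin N, cellWave L p (X j)‖₊ : ℝ≥0∞) ^ 2 * (‖Ψ.ψ X‖₊ : ℝ≥0∞) ^ 2) := by
    intro p
    refine Measurable.const_mul (Measurable.mul ?_ Ψ.measurable_normSq) _
    exact ((Finset.measurable_sum _ fun j _ =>
      (continuous_cellWave L p).measurable.comp (measurable_pi_apply j)).nnnorm.coe_nnreal_ennreal).pow_const _
  rw [lintegral_tsum fun p => (hmeas p).aemeasurable]
  refine tsum_congr fun p => ?_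
  rw [lintegral_const_mul' _ _ ENNReal.ofReal_ne_top]

/-- **The working bound.** If `0 ≤ ℓ ≤ L` and the structure factor of `Ψ` obeys `‖ρ_p†Ψ‖² ≤ S N` for
every mode `p ≠ 0` (`S ≥ 0`), then
`∫_cell ∫_{cell^N} (Σⱼ Σ_m 1[xⱼ + Lm ∈ Λ_ℓ(u)])² |Ψ|² dX du ≤ N² ℓ⁶/L³ + 27 S N ℓ³`
(zero mode `B_0 = ℓ³`, `‖ρ_0†Ψ‖² = N²`; the rest by the total box weight).
[cite: PitaevskiiStringari1991, (8)–(11)] -/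
theorem boxMoment_le_of_sq_moment_le (hL : 0 < L) (hℓ : 0 ≤ ℓ) (hℓL : ℓ ≤ L)
    (Ψ : PeriodicTrialState N L) {S : ℝ} (hS : 0 ≤ S)
    (hmode : ∀ p : Fin 3 → ℤ, p ≠ 0 →
      ∫⁻ X in cellN N L, (‖∑ j : Fin N, cellWave L p (X j)‖₊ : ℝ≥0∞) ^ 2 *
        (‖Ψ.ψ X‖₊ : ℝ≥0∞) ^ 2 ≤ ENNReal.ofReal (S * N)) :
    ∫⁻ u in cell L, ∫⁻ X in cellN N L, (∑ j : Fin N, ∑' m : Fin 3 → ℤ,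
        (slidingBox ℓ u).indicator (fun _ => (1 : ℝ≥0∞)) (X j + latticeVec L m)) ^ 2 *
          (‖Ψ.ψ X‖₊ : ℝ≥0∞) ^ 2 ≤
      ENNReal.ofReal ((N : ℝ) ^ 2 * ℓ ^ 6 / L ^ 3 + 27 * S * N * ℓ ^ 3) := by
  classical
  rw [boxMoment_eq_tsum hL hℓL Ψ]
  -- notation for the box weights and the mode moments
  set B : (Fin 3 → ℤ) → ℝ≥0∞ := fun p =>
    ENNReal.ofReal (‖∫ y in slidingBox ℓ 0, conj (cellWave L p y)‖ ^ 2) with hB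
  set Mo : (Fin 3 → ℤ) → ℝ≥0∞ := fun p =>
    ∫⁻ X in cellN N L, (‖∑ j : Fin N, cellWave L p (X j)‖₊ : ℝ≥0∞) ^ 2 * (‖Ψ.ψ X‖₊ : ℝ≥0∞) ^ 2
    with hMo
  show ENNReal.ofReal ((L ^ 3)⁻¹) * ∑' p, B p * Mo p ≤ _
  -- the zero mode
  have hB0 : B 0 = ENNReal.ofReal (ℓ ^ 6) := by
    simp only [hB]
    rw [boxCoeff_zero hℓ L, Complex.norm_real, Real.norm_of_nonneg (by positivity)]
    ring_nf
  have hMo0 : Mo 0 = (N : ℝ≥0∞) ^ 2 := by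
    simp only [hMo, cellWave_zero, Finset.sum_const, Finset.card_univ, Fintype.card_fin,
      nsmul_eq_mul, mul_one]
    rw [lintegral_const_mul _ Ψ.measurable_normSq, Ψ.norm_eq, mul_one]
    norm_cast
  -- every mode: `Mo p ≤ [p = 0] N² + S N`
  have hMo_le : ∀ p, B p * Mo p ≤ (if p = 0 then ENNReal.ofReal (ℓ ^ 6) * (N : ℝ≥0∞) ^ 2 else 0) +
      ENNReal.ofReal (S * N) * B p := by
    intro p
    by_cases hp : p = 0
    · subst hp
      rw [if_pos rfl, hB0, hMo0]
      exact le_self_add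
    · rw [if_neg hp, zero_add, mul_comm]
      exact mul_le_mul_of_nonneg_right (hmode p hp) bot_le
  have htsum : ∑' p, B p * Mo p ≤ ENNReal.ofReal (ℓ ^ 6) * (N : ℝ≥0∞) ^ 2 +
      ENNReal.ofReal (S * N) * ENNReal.ofReal (27 * L ^ 3 * ℓ ^ 3) :=
    calc ∑' p, B p * Mo p
        ≤ ∑' p : Fin 3 → ℤ, ((if p = 0 then ENNReal.ofReal (ℓ ^ 6) * (N : ℝ≥0∞) ^ 2 else 0) +
            ENNReal.ofReal (S * N) * B p) := ENNReal.tsum_le_tsum hMo_le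
      _ = ENNReal.ofReal (ℓ ^ 6) * (N : ℝ≥0∞) ^ 2 + ENNReal.ofReal (S * N) * ∑' p, B p := by
          rw [ENNReal.tsum_add, tsum_ite_eq, ENNReal.tsum_mul_left]
      _ ≤ _ := add_le_add le_rfl
          (mul_le_mul_of_nonneg_left (tsum_sq_boxCoeff_le hL hℓ hℓL) bot_le)
  -- bookkeeping in `ℝ`
  have hNr : (N : ℝ≥0∞) ^ 2 = ENNReal.ofReal ((N : ℝ) ^ 2) := by
    rw [ENNReal.ofReal_pow (Nat.cast_nonneg _), ENNReal.ofReal_natCast]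
  calc ENNReal.ofReal ((L ^ 3)⁻¹) * ∑' p, B p * Mo p
      ≤ ENNReal.ofReal ((L ^ 3)⁻¹) * (ENNReal.ofReal (ℓ ^ 6) * (N : ℝ≥0∞) ^ 2 +
          ENNReal.ofReal (S * N) * ENNReal.ofReal (27 * L ^ 3 * ℓ ^ 3)) :=
        mul_le_mul_of_nonneg_left htsum bot_le
    _ = ENNReal.ofReal ((N : ℝ) ^ 2 * ℓ ^ 6 / L ^ 3 + 27 * S * N * ℓ ^ 3) := by
        rw [hNr, ← ENNReal.ofReal_mul (by positivity), ← ENNReal.ofReal_mul (by positivity),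
          ← ENNReal.ofReal_add (by positivity) (by positivity), ← ENNReal.ofReal_mul (by positivity)]
        congr 1
        field_simp

end Summit.AtomisticToContinuum.BoseEinsteinCondensation.Theorems.CorrectorClosure.VolumeHomotopySumRuleDomination

end
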